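import Summits.PneNP.PneNP.Theorems.KrwChromaticSteeringStrongCompositionLradSteps
import Summits.PneNP.PneNP.Theorems.KrwChromaticSteeringStrongCompositionLradRowSteps
import Summits.PneNP.PneNP.Theorems.KrwChromaticSteeringStrongCompositionLradJointExistence

/-!
# Crux line `lrad-gluing` (stmt-PneNP-18538): the stub `LRADQuantitative` and the rung C1|LRAD, proved

* `invAt_of_disciplined` — the adversary theorem: every disciplined subtree satisfies the glued invariant
  `InvAt` at the typing reaching it (leaf / label / affine / single-row node by the step lemmas of
  `…LradSteps.lean`, `…LradRowSteps.lean`); `lrad_rect_bound` — its root instance (state `τ ≡ fresh`,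
  `S = T ≡ univ`, `E = []`, `k = q`, `K = dg`): every disciplined protocol for `KW_f ⊛ KW_g` has
  `ℓ + min dg q ≤ depth + 2`, in KRW form `exists_solves_of_lraDisciplined` (a `KW_f` protocol `Q` with
  `Q.depth + min dg q ≤ P.depth + 2`); `stub_lradQuantitative : LRADQuantitative` — the line's REGISTERED STUB (the
  weaker `min dg (q − 1)` form, statement verbatim).
* `strongCompositionLRAD_of_quantitative` (verbatim the skeleton's assembly §7): the adversary bound alone gives
  the crux C1 restricted to the disciplined class, loss `(c + 8) (log₂ (m n) + 1)` with `c` from S0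
  `jointHardGeneric_exists` (`…LradJointExistence.lean`), per-row budget `q = n − 2 (log₂ n + 1) − 1` by S3
  `perRowLUOfGeneric_holds`, the tree's `liftRows` embedding for the budget-free small-`n` case; and
  `strongCompositionLRAD : StrongCompositionLRAD` — the line's REGISTERED TARGET (rung), proved.
* Non-vacuity: independent play `KWTree.compose` is disciplined (`lraDisciplined_compose`), so the rung is
  matched from above inside the class up to its `O(log mn)` loss (`exists_lraDisciplined_solvesStrong`).

Closed skeleton: `Cruxes/StrongComposition/Lines/lrad_gluing.lean` (commit 499c8795953a).  Honest framing: a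
CLASS-RESTRICTED rung under Meir's open strong composition with `γ = 1`; the crux item stmt-PneNP-18538 (C1,
all protocols) stays open; nothing here bears on P vs NP.
-/

set_option linter.dupNamespace false -- `Summit.PneNP.PneNP.…`: summit = sub-problem name (D-0017 single-conjunct layout)
set_option autoImplicit false

namespace Summit.PneNP.PneNP.Theorems.KrwLrad

open Literature.Computability.Complexity

universe u

section Main

variable {m n : ℕ} {g : (Fin n → Bool) → Bool} {q : ℕ}

/-- The realisable label columns at the root: all of `A` (when `g` takes both values). -/
theorem AE_root (hg : ∀ α : Bool, ∃ x, g x = α) (A : Set (Fin m → Bool)) :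
    AE g A (fun _ => Set.univ) = A := by
  ext a
  simp only [AE, Set.mem_setOf_eq, Set.mem_univ, true_and]
  exact ⟨fun h => h.1, fun h => ⟨h, fun i => hg (a i)⟩⟩

/-- **The adversary theorem**: every disciplined subtree satisfies the glued invariant at its typing. -/
theorem invAt_of_disciplined (hLU : PerRowLU g m q) (i₀ : Fin m) (j₀ : Fin n) :
    ∀ (P : KWTree (Fin m × Fin n)) (τ : Fin m → RowType), LRADisciplinedOn g τ P → InvAt g q τ P
  | .leaf p, τ, _ => inv_leafAt hLU p τ
  | .alice s P Q, τ, h => by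
    obtain ⟨τ', hN, hP, hQ⟩ := h
    have ihP := invAt_of_disciplined hLU i₀ j₀ P τ' hP
    have ihQ := invAt_of_disciplined hLU i₀ j₀ Q τ' hQ
    rcases hN with ⟨⟨φ, hφ⟩, hτ'⟩ | ⟨S₀, c, hs, hτ, hτ'⟩ | ⟨i, ψ, hs, hτi, hτ'⟩
    · subst hτ'; exact label_stepAt_alice i₀ hφ ihP ihQ
    · subst hτ'; exact affine_stepAt_alice hLU hs hτ ihP ihQ
    · subst hτ'; exact row_stepAt_alice i₀ j₀ hs hτi ihP ihQ
  | .bob s P Q, τ, h => by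
    obtain ⟨τ', hN, hP, hQ⟩ := h
    have ihP := invAt_of_disciplined hLU i₀ j₀ P τ' hP
    have ihQ := invAt_of_disciplined hLU i₀ j₀ Q τ' hQ
    rcases hN with ⟨⟨φ, hφ⟩, hτ'⟩ | ⟨S₀, c, hs, hτ, hτ'⟩ | ⟨i, ψ, hs, hτi, hτ'⟩
    · subst hτ'; exact label_stepAt_bob i₀ hφ ihP ihQ
    · subst hτ'; exact affine_stepAt_bob hLU hs hτ ihP ihQ
    · subst hτ'; exact row_stepAt_bob i₀ j₀ hs hτi ihP ihQ

/-- **The glued adversary bound, per-row form**: with per-row budget `q` every disciplined protocol for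
the strong game has `ℓ + min dg q ≤ depth + 2`. -/
theorem lrad_rect_bound {f : (Fin m → Bool) → Bool} {dg ℓ : ℕ}
    (hf : ∃ a b, f a = true ∧ f b = false) (hdg : ∀ R : KWTree (Fin n), R.Solves g → dg ≤ R.depth)
    (hLU : PerRowLU g m q) (hH : Hard (f ⁻¹' {true}) (f ⁻¹' {false}) ℓ)
    {P : KWTree (Fin m × Fin n)} (hP : LRADisciplined g P) (hsol : P.SolvesStrong f g) :
    ℓ + min dg q ≤ P.depth + 2 := by
  classical
  -- `m ≥ 1` (f non-constant) and a coordinate `i₀`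
  obtain ⟨a₁, b₁, hfa₁, hfb₁⟩ := hf
  have hm : 0 < m := by
    rcases Nat.eq_zero_or_pos m with h0 | h0
    · exfalso
      subst h0
      have : a₁ = b₁ := funext fun i => i.elim0
      rw [this, hfb₁] at hfa₁
      exact Bool.false_ne_true hfa₁
    · exact h0
  let i₀ : Fin m := ⟨0, hm⟩
  -- `g` takes both values (per-row universality of the empty system) and a coordinate `j₀`
  have hsat0 : ∃ X, Sat ([] : AffSys m n) X := ⟨fun _ => false, fun e he => by simp at he⟩
  have hload0 : ∀ i, rowLoad ([] : AffSys m n) i ≤ q := fun i => by rw [rowLoad_nil]; exact Nat.zero_le _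
  have hgα : ∀ α : Bool, ∃ x, g x = α := by
    intro α
    obtain ⟨X, -, hX⟩ := hLU [] hload0 hsat0 (fun _ => α)
    exact ⟨row X i₀, by have := congrFun hX i₀; simpa using this⟩
  obtain ⟨x₁, hx₁⟩ := hgα true
  obtain ⟨y₁, hy₁⟩ := hgα false
  have hne_xy : x₁ ≠ y₁ := fun h => by rw [h, hy₁] at hx₁; exact Bool.false_ne_true hx₁
  obtain ⟨j₀, -⟩ : ∃ j : Fin n, x₁ j ≠ y₁ j := by
    by_contra h
    push Not at h
    exact hne_xy (funext h)
  -- the root state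
  let U : Fin m → Set (Fin n → Bool) := fun _ => Set.univ
  set A : Set (Fin m → Bool) := f ⁻¹' {true} with hA
  set B : Set (Fin m → Bool) := f ⁻¹' {false} with hB
  have hAE_A : AE g A U = A := AE_root hgα A
  have hAE_B : AE g B U = B := AE_root hgα B
  have hst : StateOK (fun _ : Fin m => RowType.fresh) U U ([] : AffSys m n) := fun i =>
    ⟨fun _ => rowLoad_nil i, fun _ => ⟨rfl, rfl⟩⟩
  have hload : ∀ i, rowLoad ([] : AffSys m n) i + q ≤ q := fun i => by rw [rowLoad_nil, Nat.zero_add]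
  have hV : ValidOnE g P A B U U [] := by
    intro X hX Y hY
    have hX1 : f (rowLabels g X) = true := by simpa [hA] using hX.1
    have hY1 : f (rowLabels g Y) = false := by simpa [hB] using hY.1
    exact hsol X Y (by rw [blockComp_apply]; exact hX1) (by rw [blockComp_apply]; exact hY1)
  have hD : ∀ a ∈ AE g A U, ∀ b ∈ AE g B U, a ≠ b := by
    rw [hAE_A, hAE_B]
    rintro a ha b hb rfl
    have ha' : f a = true := by simpa [hA] using ha
    have hb' : f a = false := by simpa [hB] using hb
    rw [ha'] at hb'
    exact Bool.noConfusion hb'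
  have hneA : (AE g A U).Nonempty := by rw [hAE_A]; exact ⟨a₁, by simpa [hA] using hfa₁⟩
  have hneB : (AE g B U).Nonempty := by rw [hAE_B]; exact ⟨b₁, by simpa [hB] using hfb₁⟩
  have hL : Hard (AE g A U) (AE g B U) ℓ := by rw [hAE_A, hAE_B]; exact hH
  have hR : ∀ i α, Alive g A B U U i α → Hard (RA g U i α) (RA g U i (!α)) dg := by
    intro i α _ R hRsol
    cases α
    · have hsol' : R.swap.Solves g := by
        intro a b ha hb
        rw [KWTree.run_swap]
        have := hRsol b ⟨Set.mem_univ _, hb⟩ a ⟨Set.mem_univ _, by simpa using ha⟩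
        exact fun h => this h.symm
      simpa using hdg R.swap hsol'
    · exact hdg R fun a b ha hb => hRsol a ⟨Set.mem_univ _, ha⟩ b ⟨Set.mem_univ _, by simpa using hb⟩
  have hK : ∀ i α, Alive g A B U U i α → dg ≤ dg + cst (AE g A U) i + cst (AE g B U) i :=
    fun _ _ _ => by omega
  exact invAt_of_disciplined hLU i₀ j₀ P _ hP A B U U [] q hst hsat0 hload hV hD hneA hneB ℓ dg
    (fun _ _ => dg) hL hR hK

/-- **KRW form of the glued bound**: from any disciplined protocol `P` for the strong composition game
`KW_f ⊛ KW_g` (`f` non-constant, `g` of KW-depth `≥ dg` and label-universal with per-row budget `q`) one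
extracts a `KW_f` protocol `Q` with `Q.depth + min dg q ≤ P.depth + 2` — i.e.
`D_LRAD(KW_f ⊛ KW_g) ≥ D(KW_f) + min(D(KW_g), q) − 2`, no `log` slack. -/
theorem exists_solves_of_lraDisciplined {f : (Fin m → Bool) → Bool} {dg : ℕ}
    (hf : ∃ a b, f a ≠ f b) (hdg : ∀ R : KWTree (Fin n), R.Solves g → dg ≤ R.depth)
    (hLU : PerRowLU g m q) {P : KWTree (Fin m × Fin n)} (hP : LRADisciplined g P)
    (hsol : P.SolvesStrong f g) :
    ∃ Q : KWTree (Fin m), Q.Solves f ∧ Q.depth + min dg q ≤ P.depth + 2 := by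
  classical
  have hne : ∃ a b, f a = true ∧ f b = false := by
    obtain ⟨a, b, hab⟩ := hf
    cases ha : f a <;> cases hb : f b
    · rw [ha, hb] at hab; exact absurd rfl hab
    · exact ⟨b, a, hb, ha⟩
    · exact ⟨a, b, ha, hb⟩
    · rw [ha, hb] at hab; exact absurd rfl hab
  by_contra hcon
  push Not at hcon
  set ℓ := P.depth + 3 - min dg q with hℓ
  have hH : Hard (f ⁻¹' {true}) (f ⁻¹' {false}) ℓ := by
    intro Q hQ
    have hs : Q.Solves f := fun a b ha hb => hQ a (by simpa using ha) b (by simpa using hb)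
    have := hcon Q hs
    omega
  have hmain := lrad_rect_bound hne hdg hLU hH hP hsol
  omega

end Main

/-- **The registered stub `stub_lradQuantitative` of line `lrad-gluing`, PROVED**: for a non-constant
outer `f` with `ℓ`-hard Karchmer–Wigderson rectangle, an inner `g` of KW-depth `≥ dg`, label-universal with
per-row budget `q ≥ 1`, every LRAD-disciplined protocol for the strong composition game `KW_f ⊛ KW_g` has
depth `≥ ℓ + min(dg, q − 1) − 2` (from the sharper per-row form `lrad_rect_bound`).  Statement VERBATIM the
skeleton's `LRADQuantitative`. -/
theorem stub_lradQuantitative : LRADQuantitative := by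
  intro m n q dg ℓ f g hf hdg hLU _hq hH P hP hsol
  have h := lrad_rect_bound hf hdg hLU hH hP hsol
  omega

section Assembly

/-- **Assembly of the rung**: the adversary bound alone gives C1 on the disciplined class, with loss
`(c + 8) (log₂ (m n) + 1)` where `c` is the constant of `jointHardGeneric_exists`. -/
theorem strongCompositionLRAD_of_quantitative (hQ : LRADQuantitative) : StrongCompositionLRAD := by
  obtain ⟨c, hc⟩ := jointHardGeneric_exists
  refine ⟨c + 8, fun m n hn f hf => ?_⟩
  obtain ⟨g, ⟨u, v, hu, hv⟩, hgen, hdepth⟩ := hc n hn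
  refine ⟨g, fun P hP hsol => ?_⟩
  have hne : ∃ a b, f a = true ∧ f b = false := by
    obtain ⟨a, b, hab⟩ := hf
    cases ha : f a <;> cases hb : f b
    · rw [ha, hb] at hab; exact absurd rfl hab
    · exact ⟨b, a, hb, ha⟩
    · exact ⟨a, b, ha, hb⟩
    · rw [ha, hb] at hab; exact absurd rfl hab
  have hm : 0 < m := by
    obtain ⟨a, b, hab⟩ := hf
    rcases Nat.eq_zero_or_pos m with h0 | h0
    · exfalso; subst h0; exact hab (congrArg f (funext fun i => i.elim0))
    · exact h0
  set L := Nat.log 2 (m * n) + 1 with hL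
  have hLn : Nat.log 2 n + 1 ≤ L := by
    have : Nat.log 2 n ≤ Nat.log 2 (m * n) := Nat.log_mono_right (Nat.le_mul_of_pos_left n hm)
    omega
  set r := 2 * (Nat.log 2 n + 1) with hr
  set q := n - r - 1 with hq
  have hLU : PerRowLU g m q := perRowLUOfGeneric_holds m n r g ⟨u, v, hu, hv⟩ hgen
  have e1 : (c + 8) * L = c * L + 8 * L := by ring
  have hcL : c * (Nat.log 2 n + 1) ≤ c * L := Nat.mul_le_mul_left _ hLn
  rcases Nat.eq_zero_or_pos q with hq0 | hq0
  · -- no affine budget (`n ≤ 2 log₂ n + 3`): the `liftRows` protocol already fits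
    refine ⟨P.comap (KWTree.liftRows u v) (KWTree.liftRows u v) Prod.fst, KWTree.solves_comap_liftRows hsol hu hv, ?_⟩
    rw [KWTree.depth_comap]
    omega
  · set dg := n - c * (Nat.log 2 n + 1) with hdg
    have hKW : ∀ R : KWTree (Fin n), R.Solves g → dg ≤ R.depth := fun R hR => by
      have := hdepth R hR; omega
    by_contra hcon
    push Not at hcon
    set ℓ := P.depth + (c + 8) * L + 1 - n with hℓ
    have hH : Hard (f ⁻¹' {true}) (f ⁻¹' {false}) ℓ := by
      intro Q hQ
      have hs : Q.Solves f := fun a b ha hb => hQ a (by simpa using ha) b (by simpa using hb)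
      have := hcon Q hs
      omega
    have hmain := hQ m n q dg ℓ f g hne hKW hLU hq0 hH P hP hsol
    omega

end Assembly

/-- **THE RUNG C1|LRAD, PROVED**: Meir's strong composition statement with `γ = 1` (crux C1
`Theses.KrwChromaticSteering.StrongComposition`, verbatim: `g` existential, loss `O(log mn)`) holds for every
protocol of the disciplined class LRAD (label ∨ affine ∨ single-row node tests, no row both affine-touched and
row-tested on a path) — the assembly applied to the proved stub `stub_lradQuantitative`.  This is the
registered target `StrongCompositionLRAD` of line `lrad-gluing`; C1 itself (all protocols) stays open. -/
theorem strongCompositionLRAD : StrongCompositionLRAD :=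
  strongCompositionLRAD_of_quantitative stub_lradQuantitative

/-! ### Non-vacuity of the rung: the obvious protocol is disciplined
The class LRAD contains INDEPENDENT PLAY (`KWTree.compose`: run a `KW_f` protocol on the label columns, then a
`KW_g` protocol on the row found), so `StrongCompositionLRAD` is matched from above by a disciplined protocol of
depth `D(KW_f) + D(KW_g) + 1` (`KWTree.depth_compose`, `KWTree.solvesStrong_compose`): the rung says no
disciplined protocol beats independent play by more than `O(log mn)` rounds. -/

section NonVacuity

variable {m n : ℕ}

/-- Playing a row protocol on row `i` (`KWTree.onRow`) is disciplined from every typing in which row `i` is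
not algebraic (all its nodes are single-row tests on row `i`). -/
theorem lraDisciplinedOn_onRow (g : (Fin n → Bool) → Bool) (i : Fin m) :
    ∀ (R : KWTree (Fin n)) (τ : Fin m → RowType), τ i ≠ RowType.algebraic →
      LRADisciplinedOn g τ (KWTree.onRow (m := m) i R)
  | .leaf _, _, _ => trivial
  | .alice s P Q, τ, hτ => by
    simp only [KWTree.onRow, KWTree.comap]
    refine ⟨Function.update τ i .combinatorial, Or.inr (Or.inr ⟨i, s, fun X => rfl, hτ, rfl⟩), ?_, ?_⟩
    · exact lraDisciplinedOn_onRow g i P _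
        (by rw [Function.update_self]; exact fun h => RowType.noConfusion h)
    · exact lraDisciplinedOn_onRow g i Q _
        (by rw [Function.update_self]; exact fun h => RowType.noConfusion h)
  | .bob s P Q, τ, hτ => by
    simp only [KWTree.onRow, KWTree.comap]
    refine ⟨Function.update τ i .combinatorial, Or.inr (Or.inr ⟨i, s, fun X => rfl, hτ, rfl⟩), ?_, ?_⟩
    · exact lraDisciplinedOn_onRow g i P _
        (by rw [Function.update_self]; exact fun h => RowType.noConfusion h)
    · exact lraDisciplinedOn_onRow g i Q _
        (by rw [Function.update_self]; exact fun h => RowType.noConfusion h)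

/-- The obvious protocol `KWTree.compose g R Q` is disciplined from every typing without algebraic rows: its
nodes are label tests (those of `Q` on the label columns) and single-row tests (the announcement `g(X_i)` and
the nodes of `R` on row `i`). -/
theorem lraDisciplinedOn_compose (g : (Fin n → Bool) → Bool) (R : KWTree (Fin n)) :
    ∀ (Q : KWTree (Fin m)) (τ : Fin m → RowType), (∀ i, τ i ≠ RowType.algebraic) →
      LRADisciplinedOn g τ (KWTree.compose g R Q)
  | .leaf i, τ, hτ => by
    simp only [KWTree.compose]
    refine ⟨Function.update τ i .combinatorial, Or.inr (Or.inr ⟨i, g, fun X => rfl, hτ i, rfl⟩), ?_, ?_⟩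
    · exact lraDisciplinedOn_onRow g i R.swap _
        (by rw [Function.update_self]; exact fun h => RowType.noConfusion h)
    · exact lraDisciplinedOn_onRow g i R _
        (by rw [Function.update_self]; exact fun h => RowType.noConfusion h)
  | .alice s P Q, τ, hτ => by
    simp only [KWTree.compose]
    exact ⟨τ, Or.inl ⟨⟨s, fun X => rfl⟩, rfl⟩, lraDisciplinedOn_compose g R P τ hτ,
      lraDisciplinedOn_compose g R Q τ hτ⟩
  | .bob s P Q, τ, hτ => by
    simp only [KWTree.compose]
    exact ⟨τ, Or.inl ⟨⟨s, fun X => rfl⟩, rfl⟩, lraDisciplinedOn_compose g R P τ hτ,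
      lraDisciplinedOn_compose g R Q τ hτ⟩

/-- **Independent play is disciplined**: `KWTree.compose g R Q ∈ LRAD`. -/
theorem lraDisciplined_compose (g : (Fin n → Bool) → Bool) (R : KWTree (Fin n)) (Q : KWTree (Fin m)) :
    LRADisciplined g (KWTree.compose g R Q) :=
  lraDisciplinedOn_compose g R Q _ fun _ h => RowType.noConfusion h

/-- **The rung is matched from above inside the class**: from any `KW_f` protocol `Q` and `KW_g` protocol `R`
a DISCIPLINED protocol for the strong game of depth `Q.depth + R.depth + 1` (so `StrongCompositionLRAD` says:
no disciplined protocol beats independent play by more than `O(log mn)` rounds). -/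
theorem exists_lraDisciplined_solvesStrong {f : (Fin m → Bool) → Bool} {g : (Fin n → Bool) → Bool}
    {Q : KWTree (Fin m)} {R : KWTree (Fin n)} (hQ : Q.Solves f) (hR : R.Solves g) :
    ∃ P : KWTree (Fin m × Fin n), LRADisciplined g P ∧ P.SolvesStrong f g ∧
      P.depth = Q.depth + R.depth + 1 :=
  ⟨KWTree.compose g R Q, lraDisciplined_compose g R Q, KWTree.solvesStrong_compose hQ hR,
    KWTree.depth_compose g R Q⟩

end NonVacuity

end Summit.PneNP.PneNP.Theorems.KrwLrad
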